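import Summits.SmoothPoincare4.SmoothPoincare4.Theorems.EntropyRungConicalGapRicciNormSqCutoff
import HarnessLib

/-!
# Helper `helper_compactRicciTestIdentity` of line `Sketch` — the compactly supported second-order
# (Ricci) test-function identity (crux `EntropyRung.ConicalGap`, stmt-SmoothPoincare4-16589;
# cycle 5, localisation to sublevel sets)

**The second-order test-function identity with compact support.** On a gradient shrinking Ricci
soliton `Ric + Hess f = g/2` (any dimension `n`, `g` Riemannian, `f` smooth with compact sublevel
sets), for every `η ∈ C¹_c(ℝ)` the function

  `(η(f) + η′(f)) g⁻¹(dR, df) + η(f) (R − 2|Ric|²)`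

is continuous with compact support (so `dV`-integrable) and `∫ [(η(f) + η′(f)) g⁻¹(dR, df) +
η(f)(R − 2|Ric|²)] dV = 0`. Proof: the test function `u = η ∘ f` is `C¹` with compact support in
`{f ≤ sup tsupport η}`; by Hamilton's identity `ΔR = g⁻¹(dR, df) + R − 2|Ric|²`
(`dalembertian_scalarCurvature_of_soliton`, `λ = 1/2`) and the chain rule `du = η′(f) df`
(`mvfderiv_real_comp_apply`, symmetry of `g⁻¹`) the integrand equals `u ΔR + g⁻¹(du, dR)`
pointwise, and Green's first identity `∫ u ΔR dV = −∫ g⁻¹(du, dR) dV`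
(`integral_mul_dalembertian_eq_neg_integral_innerDual_of_hasCompactSupport`) makes its integral
vanish. This is the computation `2 ∫ u |Ric|² = ∫ u R + ∫ (u + Ψ′(f)) g⁻¹(dR, df)` of
`EntropyRungConicalGapRicciNormSqCutoff.lean` (there `u = Ψ(f)`, `Ψ(t) = φ(t/ρ)² e^{-t/τ}`) for an
arbitrary compactly supported `C¹` profile (`compactRicciTestIdentity_riemVolume`, over
`g.riemVolume`; registered 4-d form `helper_compactRicciTestIdentity`, where the compactness of the
sublevel sets of `f` is
`NoncompactShrinkerGapCarrilloNiClauses.scalarCurvature_nonneg_and_isCompact_sublevel`). Everything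
here is proved; no definition and no named fact is introduced.

## References

* O. Munteanu, J. Wang, *Structure at infinity for shrinking Ricci solitons*, arXiv:1606.01861, §2
  (p. 6) (`Δ_f R = R − 2|Ric|²`, `∇R = 2Ric(∇f)`). [MunteanuWang2016]
* O. Munteanu, N. Sesum, *On gradient Ricci solitons*, J. Geom. Anal. 23 (2013) 539–561, §2
  (integral identities for `R` and `|Ric|²` against cut-offs of `f`). [MunteanuSesum2013]
* [CarrilloNi2009] J. Carrillo, L. Ni, Comm. Anal. Geom. 17 (2009) 721–753, §2 (cut-off
  technique along the proper potential).
-/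

noncomputable section

-- `Summit.SmoothPoincare4.SmoothPoincare4.…` (summit = problem) trips `dupNamespace` on every decl.
set_option linter.dupNamespace false

open scoped Manifold ContDiff ENNReal NNReal Topology
open MeasureTheory Set Filter
open Literature.Geometry.Lorentzian Literature.Geometry.Riemannian

namespace Summit.SmoothPoincare4.SmoothPoincare4.Theorems.ConicalGapSketch

open CarrilloNi2009_shrinkerLSI

/-! ## Compact support of `ψ ∘ f` for a proper `f` -/

/-- A compactly supported profile `ψ` composed with a function `f` whose sublevel sets are compact
has compact support: `ψ (f x) = 0` off the compact sublevel set `{f ≤ sup tsupport ψ}`. -/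
theorem hasCompactSupport_comp_of_isCompact_sublevel {M : Type*} [TopologicalSpace M] [T2Space M]
    {f : M → ℝ} {ψ : ℝ → ℝ} (hψ : HasCompactSupport ψ)
    (hprop : ∀ R : ℝ, IsCompact {x | f x ≤ R}) : HasCompactSupport fun x ↦ ψ (f x) := by
  obtain ⟨B, hB⟩ := hψ.isCompact.bddAbove
  exact HasCompactSupport.intro (hprop B) fun x hx ↦
    image_eq_zero_of_notMem_tsupport fun h ↦ hx (hB h)

/-! ## The identity over `g.riemVolume` (any dimension) -/

section ProperGreen

variable {n : ℕ} {M : Type*} [TopologicalSpace M] [ChartedSpace (EuclideanSpace ℝ (Fin n)) M]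
  [IsManifold (𝓡 n) ∞ M] [T3Space M] [MeasurableSpace M] [BorelSpace M]
  {g : PseudoRiemannianMetric (𝓡 n) ∞ (EuclideanSpace ℝ (Fin n)) (TangentSpace (𝓡 n) : M → Type _)}
  {f : M → ℝ} [g.HasLeviCivita]

/-- **The compactly supported second-order (Ricci) test-function identity** (any dimension): for
`g` Riemannian, `f` smooth with compact sublevel sets and `Ric + Hess f = g/2`, and a compactly
supported `C¹` profile `η`, the function `(η(f) + η′(f)) g⁻¹(dR, df) + η(f)(R − 2|Ric|²)` is
integrable for `g.riemVolume` and `∫ [(η(f) + η′(f)) g⁻¹(dR, df) + η(f)(R − 2|Ric|²)] dV = 0`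
(Green's first identity for `u = η ∘ f` against `R`, Hamilton's identity
`ΔR = g⁻¹(dR, df) + R − 2|Ric|²`, and `du = η′(f) df`). -/
theorem compactRicciTestIdentity_riemVolume (hg : g.IsRiemannian)
    (hf : ContMDiff (𝓡 n) 𝓘(ℝ, ℝ) ∞ f)
    (hsol : ∀ (x : M) (X Y : TangentSpace (𝓡 n) x),
      g.ricci x X Y + g.hessian f x X Y = (1 / 2 : ℝ) * g.val x X Y)
    (hprop : ∀ R : ℝ, IsCompact {x | f x ≤ R}) {η : ℝ → ℝ} (hη : ContDiff ℝ 1 η)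
    (hηc : HasCompactSupport η) :
    Integrable (fun x ↦ (η (f x) + deriv η (f x)) *
        g.innerDual x (mvfderiv (𝓡 n) g.scalarCurvature x).toLinearMap
          (mvfderiv (𝓡 n) f x).toLinearMap +
        η (f x) * (g.scalarCurvature x - 2 * g.normSq x (g.ricci x))) g.riemVolume ∧
    ∫ x, ((η (f x) + deriv η (f x)) *
        g.innerDual x (mvfderiv (𝓡 n) g.scalarCurvature x).toLinearMap
          (mvfderiv (𝓡 n) f x).toLinearMap +
        η (f x) * (g.scalarCurvature x - 2 * g.normSq x (g.ricci x))) ∂g.riemVolume = 0 := by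
  classical
  -- adapted from `ricciNormSq_cutoff_integral_le` (EntropyRungConicalGapRicciNormSqCutoff.lean)
  -- topology supplied by the exhaustion; `dV` finite on compact sets
  haveI : SigmaCompactSpace M := ⟨⟨fun k : ℕ ↦ {x | f x ≤ k}, fun k ↦ hprop k,
    eq_univ_of_forall fun x ↦ mem_iUnion.2 (exists_nat_ge (f x))⟩⟩
  haveI : WeaklyLocallyCompactSpace M := ⟨fun x ↦ ⟨{y | f y ≤ f x + 1}, hprop _, by
    have hopen : IsOpen {y | f y < f x + 1} := isOpen_lt hf.continuous continuous_const
    exact mem_of_superset (hopen.mem_nhds (show x ∈ {y | f y < f x + 1} from lt_add_one (f x)))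
      fun y hy ↦ show f y ≤ f x + 1 from le_of_lt hy⟩⟩
  haveI := isFiniteMeasureOnCompacts_riemVolume hg
  -- notation
  set N : M → ℝ := fun x ↦ g.normSq x (g.ricci x) with hNdef
  set X : M → ℝ := fun x ↦ g.innerDual x (mvfderiv (𝓡 n) g.scalarCurvature x).toLinearMap
    (mvfderiv (𝓡 n) f x).toLinearMap with hXdef
  set u : M → ℝ := fun x ↦ η (f x) with hu
  set u' : M → ℝ := fun x ↦ deriv η (f x) with hu'
  show Integrable (fun x ↦ (u x + u' x) * X x + u x * (g.scalarCurvature x - 2 * N x))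
      g.riemVolume ∧
    ∫ x, ((u x + u' x) * X x + u x * (g.scalarCurvature x - 2 * N x)) ∂g.riemVolume = 0
  -- continuity of the players
  have hNc : Continuous N := (g.contMDiff_normSq_ricci').continuous
  have hS1 : ContMDiff (𝓡 n) 𝓘(ℝ, ℝ) 1 g.scalarCurvature :=
    (PseudoRiemannianMetric.contMDiff_scalarCurvature g).of_le ENat.LEInfty.out
  have hS2 : ContMDiff (𝓡 n) 𝓘(ℝ, ℝ) 2 g.scalarCurvature :=
    (PseudoRiemannianMetric.contMDiff_scalarCurvature g).of_le ENat.LEInfty.out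
  have hf1 : ContMDiff (𝓡 n) 𝓘(ℝ, ℝ) 1 f := hf.of_le ENat.LEInfty.out
  have hXc : Continuous X := continuous_innerDual_mvfderiv g hS1 hf1
  have hRc : Continuous fun x ↦ g.scalarCurvature x :=
    (PseudoRiemannianMetric.contMDiff_scalarCurvature g).continuous
  -- the test function `u = η ∘ f` and `η′ ∘ f`: `C¹` resp. continuous, compact support
  have hus : ContMDiff (𝓡 n) 𝓘(ℝ, ℝ) 1 u := hη.comp_contMDiff hf1
  have hucont : Continuous u := hus.continuous
  have hu'cont : Continuous u' := hη.continuous_deriv_one.comp hf.continuous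
  have huc : HasCompactSupport u := hasCompactSupport_comp_of_isCompact_sublevel hηc hprop
  have hu'c : HasCompactSupport u' :=
    hasCompactSupport_comp_of_isCompact_sublevel hηc.deriv hprop
  -- Green's identity for `u` against `R`
  have hGreen : ∫ x, u x * g.dalembertian g.scalarCurvature x ∂g.riemVolume =
      -∫ x, g.innerDual x (mvfderiv (𝓡 n) u x).toLinearMap
        (mvfderiv (𝓡 n) g.scalarCurvature x).toLinearMap ∂g.riemVolume := by
    haveI := (PseudoRiemannianMetric.ofRiemannian (g.toContMDiffRiemannianMetric hg)).hasLeviCivita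
    have h1 := integral_mul_dalembertian_eq_neg_integral_innerDual_of_hasCompactSupport
      (g.toContMDiffRiemannianMetric hg) hus huc hS2
    rw [PseudoRiemannianMetric.riemVolume_eq hg]
    exact h1
  -- the chain rule `du = η′(f) df` inside `g⁻¹(du, dR)`
  have hdu : ∀ x, g.innerDual x (mvfderiv (𝓡 n) u x).toLinearMap
      (mvfderiv (𝓡 n) g.scalarCurvature x).toLinearMap = u' x * X x := fun x ↦ by
    have hfx : MDifferentiableAt (𝓡 n) 𝓘(ℝ, ℝ) f x := hf.mdifferentiableAt (by norm_num)
    have hηd : HasDerivAt η (deriv η (f x)) (f x) :=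
      (hη.differentiable one_ne_zero _).hasDerivAt
    have hd : (mvfderiv (𝓡 n) u x).toLinearMap = (u' x) • (mvfderiv (𝓡 n) f x).toLinearMap := by
      ext w
      have := mvfderiv_real_comp_apply (I := 𝓡 n) hηd hfx w
      simpa [hu, hu', Function.comp_def] using this
    rw [hd]
    have h1 : g.innerDual x (u' x • (mvfderiv (𝓡 n) f x).toLinearMap)
        (mvfderiv (𝓡 n) g.scalarCurvature x).toLinearMap =
        u' x * g.innerDual x (mvfderiv (𝓡 n) f x).toLinearMap
          (mvfderiv (𝓡 n) g.scalarCurvature x).toLinearMap := by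
      simp only [PseudoRiemannianMetric.innerDual, LinearMap.smul_apply, smul_eq_mul]
    rw [h1, g.innerDual_comm x]
  -- Hamilton's identity, multiplied by `u`: the integrand is `u ΔR + η′(f) g⁻¹(dR, df)`
  have hpt : ∀ x, (u x + u' x) * X x + u x * (g.scalarCurvature x - 2 * N x) =
      u x * g.dalembertian g.scalarCurvature x + u' x * X x := fun x ↦ by
    rw [dalembertian_scalarCurvature_of_soliton g hf hsol x]
    simp only [hXdef, hNdef]
    ring
  -- integrability of the compactly supported continuous pieces
  have hvcont : Continuous fun x ↦ u x + u' x := hucont.add hu'cont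
  have hvc : HasCompactSupport fun x ↦ u x + u' x := huc.add hu'c
  have i1 : Integrable (fun x ↦ (u x + u' x) * X x) g.riemVolume :=
    (hvcont.mul hXc).integrable_of_hasCompactSupport hvc.mul_right
  have i2 : Integrable (fun x ↦ u x * (g.scalarCurvature x - 2 * N x)) g.riemVolume :=
    (hucont.mul (hRc.sub (continuous_const.mul hNc))).integrable_of_hasCompactSupport huc.mul_right
  have iu'X : Integrable (fun x ↦ u' x * X x) g.riemVolume :=
    (hu'cont.mul hXc).integrable_of_hasCompactSupport hu'c.mul_right
  have iInt : Integrable (fun x ↦ (u x + u' x) * X x + u x * (g.scalarCurvature x - 2 * N x))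
      g.riemVolume := i1.add i2
  have iuΔ : Integrable (fun x ↦ u x * g.dalembertian g.scalarCurvature x) g.riemVolume :=
    (iInt.sub iu'X).congr (Eventually.of_forall fun x ↦ by
      show (u x + u' x) * X x + u x * (g.scalarCurvature x - 2 * N x) - u' x * X x = _
      rw [hpt x]
      ring)
  refine ⟨iInt, ?_⟩
  -- integrate: `∫ (u ΔR + η′(f) X) = -∫ η′(f) X + ∫ η′(f) X = 0`
  have h2 : ∫ x, g.innerDual x (mvfderiv (𝓡 n) u x).toLinearMap
      (mvfderiv (𝓡 n) g.scalarCurvature x).toLinearMap ∂g.riemVolume =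
      ∫ x, u' x * X x ∂g.riemVolume := integral_congr_ae (Eventually.of_forall hdu)
  have hI : ∫ x, ((u x + u' x) * X x + u x * (g.scalarCurvature x - 2 * N x)) ∂g.riemVolume =
      (∫ x, u x * g.dalembertian g.scalarCurvature x ∂g.riemVolume) +
        ∫ x, u' x * X x ∂g.riemVolume := by
    rw [← integral_add iuΔ iu'X]
    exact integral_congr_ae (Eventually.of_forall hpt)
  rw [hI, hGreen, h2]
  ring

end ProperGreen

/-! ## The registered helper (n = 4, crux vocabulary) -/

/-- **Helper `helper_compactRicciTestIdentity` of line `Sketch`** (the compactly supported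
second-order test-function identity, `n = 4`): on every complete connected normalised 4-d gradient
shrinking Ricci soliton (`Ric + Hess f = g/2`, `R + |∇f|² = f`, closed `g`-balls compact) and for
every compactly supported `C¹` profile `η`, the function
`(η(f) + η′(f)) g⁻¹(dR, df) + η(f)(R − 2|Ric|²)` is integrable for the Riemannian measure `dV` of
`g.toContMDiffRiemannianMetric hg` and `∫ [(η(f) + η′(f)) g⁻¹(dR, df) + η(f)(R − 2|Ric|²)] dV = 0`:
compactness of the sublevel sets of `f`
(`NoncompactShrinkerGapCarrilloNiClauses.scalarCurvature_nonneg_and_isCompact_sublevel`), then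
`compactRicciTestIdentity_riemVolume`. -/
theorem helper_compactRicciTestIdentity : ∀ (M : Type) [TopologicalSpace M] [T2Space M] [SecondCountableTopology M] [ChartedSpace (EuclideanSpace ℝ (Fin 4)) M] [IsManifold (𝓡 4) ∞ M] [ConnectedSpace M] [T3Space M] [MeasurableSpace M] [BorelSpace M] (g : Literature.Geometry.Lorentzian.PseudoRiemannianMetric (𝓡 4) ∞ (EuclideanSpace ℝ (Fin 4)) (TangentSpace (𝓡 4) : M → Type _)) [g.HasLeviCivita] (f : M → ℝ) (hg : g.IsRiemannian), (∀ (x : M) (r : NNReal), IsCompact {y : M | g.edist hg x y ≤ r}) → ContMDiff (𝓡 4) 𝓘(ℝ, ℝ) ∞ f → (∀ (x : M) (X Y : TangentSpace (𝓡 4) x), g.ricci x X Y + g.hessian f x X Y = (1 / 2 : ℝ) * g.val x X Y) → (∀ x : M, g.scalarCurvature x + g.gradSq f x = f x) → ∀ η : ℝ → ℝ, ContDiff ℝ 1 η → HasCompactSupport η → MeasureTheory.Integrable (fun x ↦ (η (f x) + deriv η (f x)) * g.innerDual x (mvfderiv (𝓡 4) g.scalarCurvature x).toLinearMap (mvfderiv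 (𝓡 4) f x).toLinearMap + η (f x) * (g.scalarCurvature x - 2 * g.normSq x (g.ricci x))) (Literature.Geometry.Lorentzian.riemannianMeasure (g.toContMDiffRiemannianMetric hg)) ∧ ∫ x, ((η (f x) + deriv η (f x)) * g.innerDual x (mvfderiv (𝓡 4) g.scalarCurvature x).toLinearMap (mvfderiv (𝓡 4) f x).toLinearMap + η (f x) * (g.scalarCurvature x - 2 * g.normSq x (g.ricci x))) ∂(Literature.Geometry.Lorentzian.riemannianMeasure (g.toContMDiffRiemannianMetric hg)) = 0 := by
  intro M _ _ _ _ _ _ _ _ _ g _ f hg hc hf hsol hnorm η hη hηc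
  obtain ⟨-, -, hprop⟩ :=
    NoncompactShrinkerGapCarrilloNiClauses.scalarCurvature_nonneg_and_isCompact_sublevel g f hg hc hf
      hsol hnorm
  rw [← PseudoRiemannianMetric.riemVolume_eq hg]
  exact compactRicciTestIdentity_riemVolume hg hf hsol hprop hη hηc

end Summit.SmoothPoincare4.SmoothPoincare4.Theorems.ConicalGapSketch

end
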